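/-
Copyright: the b2b-balaban T⁴-continuum CRUX team, row NE7b, leaf lineage `t4-ne7b-formalise-leaf-02` (gen 133). Project licence.
-/
import Summits.QuantumFields.BalabanUV.T4Continuum.Spine.NE7b.OneStepAveragingRemainder
import Literature.MathematicalPhysics.QuantumFieldTheory.Balaban1983to89.T4TermwiseTorus

/-!
# THE (R-M) LETTER AT ONE STEP ON THE TWO-SCALE TORUS: for `LM`-periodic data read through [B7]'s `ℤ^d` objects at the base points `qb y = L·y`,
# `Σ_{c=(y,κ)} ‖L⁻¹·L(Q(V̄₀)A)_c − (Q₀A)_c‖² ≤ (50(d+1)·16(d+1)(d+4)L²α₀)²·2d·Σ_b ‖A(b)‖²` — the remainder of the linear one-step average against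
# (125)'s main part, squared and summed over the coarse bonds of `(ℤ∕M)^d`, against the fine 1-form on the bonds of `(ℤ∕LM)^d`
# (row NE7b, node U5c; `HOME/b2b-balaban-r1/SectE-interface-proof.md` §5.3 (R-M) at `k = 1`: «`Σ_{c∈Λ_k}|(E_kA)(c)|² ≤ c_E²ε_F²‖A‖²_{L²(Ω_k)}`»;
# E-side key reading — the `hE` letter of `…AveragedCurlFormSplit.curlForm_letter_of_split` BY VALUE on the torus of `…OneStepCoarseCurlL2`)

Cell `pub-balaban`, sub-cell `t4`, spine estimate NE7b (`T4WeightBudget.RelWeightBound`; the cell's OWN estimate — NOT PRINTED in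
[Bałaban 1983–89], NOT PROVED).  Crux-route work under `Spine/NE7b/` by the row's E-side ∕ key-readings ∕ lattice-geometry leaf lineage; a
[folklore] junction BY NAME over this lineage's `…OneStepAveragingRemainder` (gen 132: `normSq_remainder_le_local` — (126) localised and squared at
ONE coarse bond of `ℤ^d`; `card_filter_box_le` — the `ℤ^d` box multiplicity `2d` from `B7Prop5Flat` BY NAME; `sum_sum_filter_le` — the double
count) and `Literature.….T4TermwiseTorus` (`tcls`, `tlift`); NOTHING of Bałaban's is asserted beyond what those modules prove; no
`T4Continuum/Support` leaf typed; no `def`, no notation, no instance — the torus box bond sets `Bx c` and the torus bond sizes `Ab` are carried by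
characterising hypotheses (`hBx`: the image of [B7]'s `bondsIn (qb y) (bondHi L (qb y) κ)` under `b ↦ (tcls (LM) b₋, dir b)`; `hA : Ab (tcls (LM) y, ν)
= ‖A(y,ν)‖` — it ENCODES the `LM`-periodicity of the sizes, inhabited by `…OneStepAveragePeriodicity.exists_bondSize_torus`); zero `sorry`.

WHY (located).  `…OneStepAveragingRemainder.sum_normSq_remainder_le_lattice` is the (R-M) letter at `k = 1` over a finite family of coarse
bonds of `ℤ^d` against a finite set `T` of FINE bonds of `ℤ^d`.  On the torus the coarse family is ALL of `(ℤ∕M)^d × (directions)` and the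
fine sum must run over the bonds of `(ℤ∕LM)^d` ONCE EACH: the boxes `B(c₋) ∪ B(c₊)` of the coarse bonds `c = (y, κ)` with `y_κ = M − 1` wrap
past the period, so their `ℤ^d` bonds must be re-indexed through the class map (injective on a box iff the box — side `2L` in direction `κ` —
fits in one period: `2 ≤ M`), and the multiplicity of a TORUS fine bond among the torus boxes must be counted (`2d`; here by LIFTING to the
`ℤ^d` count of `…OneStepAveragingRemainder.card_filter_box_le`: a torus coarse bond whose box class contains `β` lifts, by the period vector
of a witness, to a `ℤ^d` coarse bond whose box contains the standard representative of `β`, injectively).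

WHAT IS PROVED ([folklore]):
* §1 boxes translate: `bondHi_add`, `inBox_add_iff`, `mem_bondsIn_add_iff` (`b ∈ bondsIn q (bondHi L q κ) ↔ b + v ∈ bondsIn (q+v) (bondHi L (q+v) κ)`).
* §2 **`tcls_injOn_bondsIn`**: for `2 ≤ M` the class map `b ↦ (tcls (LM) b₋, dir b)` is injective on `bondsIn (qb y) (bondHi L (qb y) κ)`.
* §3 **`sum_bondsIn_eq_sum_Bx`**: `Σ_{b ∈ bondsIn (qb y) (bondHi L (qb y) κ)} ‖A(b)‖² = Σ_{β ∈ Bx (y,κ)} Ab β²` (`Finset.sum_image` + `hA`).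
* §4 **`card_filter_Bx_le`**: a torus fine bond `β` lies in `Bx c` for at most `2d` torus coarse bonds `c` (lift + `card_filter_box_le` BY NAME);
  `sum_sum_Bx_le`: `Σ_c Σ_{β ∈ Bx c} g β ≤ 2d·Σ_β g β` for `g ≥ 0` (`sum_sum_filter_le` BY NAME).
* §5 **`sum_normSq_remainder_torus_le`** — THE LETTER: for `V₀` in the unit ball class `U1` with (44) `‖V₀(∂p) − 1‖ ≤ α₀`,
  `512(d+1)(d+4)L²α₀ ≤ 1`, `1 ≤ L`, `2 ≤ M`:
  `Σ_{c} ‖L⁻¹ • linQcov L V₀ A (qb c.1) c.2 − Q0cov L V₀ A (qb c.1) c.2‖² ≤ (50(d+1)·(16(d+1)(d+4)L²α₀))²·(2d)·Σ_β (Ab β)²`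
  (per bond `normSq_remainder_le_local` with `ε := 16(d+1)(d+4)L²α₀ ≤ 1∕32` from `B7Prop2Explicit.norm_Wcx_sub_one_le`, §3, §4);
  `sum_normSq_remainder_torus_le'` — the same with the remainder written `linQcov − L • Q0cov` and the factor `L²` on the right.

HONEST SHAPE.  Against the memo's (R-M) at `k = 1`: `c_E = 50(d+1)·16(d+1)(d+4)L²α₀·√(2d) = O(d^{5∕2}L²α₀)` in lattice units, before the
`L²(η)` normalisation (`‖A‖²_{L²(Ω_k)}` carries `η^d`; NOT HERE).  NOT HERE: `k > 1` ((134), (139)–(143): the composed operator), the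
identification with CED's letters, anything of Bałaban's ((A3) ∕ (A1c), NC-NE7b-α UNRULED).  BY-NAME EFFECT ON THE WALL: NONE (the (h1) slot's
`hE` letter at `k = 1`; the wall is (R2)).  NE7b NOT PRINTED ∕ NOT PROVED; spine PROVED 0∕9; rung (B)+1 on a FINITE torus — NOT infinite
volume, NOT the mass gap, NOT Clay.
HONEST DEPENDENCY: continuum YM on T⁴ ⇐ BetaPertH ∧ nine spine estimates (0/9 proved); BetaPertH ⇐ (D1) ∧ (D4) ∧ CAP+tail; G-an2-4 gates
asym, D1 and NE2/3/4.
-/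

set_option autoImplicit false

noncomputable section

open scoped BigOperators
open Finset
open Literature.MathematicalPhysics.QuantumFieldTheory.Balaban1983to89
open Literature.MathematicalPhysics.QuantumFieldTheory.Balaban1983to89.B7Prop1Explicit (Site e hol boxVec Wcx U1 plaqWord)
open Literature.MathematicalPhysics.QuantumFieldTheory.Balaban1983to89.B7Prop1Local (InBox bondHi loK)
open Literature.MathematicalPhysics.QuantumFieldTheory.Balaban1983to89.B7Prop5Flat (BondIn bondsIn mem_bondsIn)
open Literature.MathematicalPhysics.QuantumFieldTheory.Balaban1983to89.B7Prop3GeneralLinear (Q0cov linQcov)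
open Literature.MathematicalPhysics.QuantumFieldTheory.Balaban1983to89.T4TermwiseTorus (tcls tcls_apply tlift tcls_tlift tcls_eq_tcls_iff)

namespace Summit.QuantumFields.BalabanUV.T4Continuum.NE7b.OneStepRemainderTorus

variable {d : ℕ}

/-! ## §1 Boxes translate -/

section Translate

/-- the upper corner of `B(c₋) ∪ B(c₊)` moves with the base point. [folklore] -/
theorem bondHi_add (L : ℕ) (q v : Site d) (κ : Fin d) : bondHi L (q + v) κ = bondHi L q κ + v := by
  funext i
  simp only [bondHi, Pi.add_apply]
  ring

/-- membership in a box is translation invariant. [folklore] -/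
theorem inBox_add_iff (lo hi x v : Site d) : InBox (lo + v) (hi + v) (x + v) ↔ InBox lo hi x := by
  simp only [InBox, Pi.add_apply, add_le_add_iff_right]

/-- **the box bond sets translate**: `b ∈ bondsIn q (bondHi L q κ) ↔ (b₋ + v, dir b) ∈ bondsIn (q + v) (bondHi L (q + v) κ)`. [folklore] -/
theorem mem_bondsIn_add_iff (L : ℕ) (q v : Site d) (κ : Fin d) (x : Site d) (ν : Fin d) :
    (x + v, ν) ∈ bondsIn (q + v) (bondHi L (q + v) κ) ↔ (x, ν) ∈ bondsIn q (bondHi L q κ) := by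
  rw [mem_bondsIn, mem_bondsIn, BondIn, BondIn, bondHi_add, add_right_comm x v (e ν), inBox_add_iff, inBox_add_iff]

end Translate

/-! ## §2 The class map is injective on a box when `2 ≤ M` -/

section Inject

variable (L M : ℕ) (hL : 1 ≤ L) (hM : 2 ≤ M)

include hL hM in
/-- two points of one box `B(c₋) ∪ B(c₊)` (side `≤ 2L` in every direction) with the same class modulo `LM ≥ 2L` coincide. [folklore] -/
theorem eq_of_inBox_of_tcls_eq (q : Site d) (κ : Fin d) {x x' : Site d}
    (hx : InBox q (bondHi L q κ) x) (hx' : InBox q (bondHi L q κ) x') (h : tcls (L * M) x = tcls (L * M) x') : x = x' := by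
  obtain ⟨m, hm⟩ := (tcls_eq_tcls_iff (L * M)).1 h
  rw [hm]
  suffices hm0 : m = 0 by rw [hm0, smul_zero, add_zero]
  funext i
  have h1 := hx i
  have h2 := hx' i
  rw [hm] at h2
  simp only [bondHi, Pi.add_apply, Pi.smul_apply, smul_eq_mul] at h1 h2
  have hLM : (2 : ℤ) * L ≤ ((L * M : ℕ) : ℤ) := by push_cast; nlinarith
  have hL1 : (1 : ℤ) ≤ L := by exact_mod_cast hL
  have hite : (0 : ℤ) ≤ (if i = κ then (L : ℤ) else 0) ∧ (if i = κ then (L : ℤ) else 0) ≤ L := by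
    split_ifs <;> constructor <;> linarith
  -- `|LM · m i| ≤ 2L − 1 < LM`
  have hup : ((L * M : ℕ) : ℤ) * m i ≤ 2 * L - 1 := by linarith [h1.1, h2.2, hite.2]
  have hlo : -(2 * (L : ℤ) - 1) ≤ ((L * M : ℕ) : ℤ) * m i := by linarith [h1.2, h2.1, hite.2, hite.1]
  rcases lt_trichotomy (m i) 0 with hneg | hzero | hpos
  · have : ((L * M : ℕ) : ℤ) * m i ≤ ((L * M : ℕ) : ℤ) * (-1) :=
      mul_le_mul_of_nonneg_left (by omega) (by positivity)
    linarith
  · exact hzero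
  · have : ((L * M : ℕ) : ℤ) * 1 ≤ ((L * M : ℕ) : ℤ) * m i :=
      mul_le_mul_of_nonneg_left (by omega) (by positivity)
    linarith

include hL hM in
/-- **THE CLASS MAP IS INJECTIVE ON A BOX BOND SET** (`2 ≤ M`): `b ↦ (tcls (LM) b₋, dir b)` on `bondsIn (qb y) (bondHi L (qb y) κ)`. [folklore] -/
theorem tcls_injOn_bondsIn (q : Site d) (κ : Fin d) :
    Set.InjOn (fun b : Site d × Fin d => (tcls (L * M) b.1, b.2)) (bondsIn q (bondHi L q κ) : Set (Site d × Fin d)) := by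
  rintro ⟨x, ν⟩ hb ⟨x', ν'⟩ hb' h
  simp only [Finset.mem_coe, mem_bondsIn, BondIn] at hb hb'
  simp only [Prod.mk.injEq] at h ⊢
  exact ⟨eq_of_inBox_of_tcls_eq L M hL hM q κ hb.1 hb'.1 h.1, h.2⟩

end Inject

/-! ## §3 Re-indexing a box bond sum to the torus -/

section Reindex

variable {𝔸 : Type*} [NormedRing 𝔸]
variable (L M : ℕ) (hL : 1 ≤ L) (hM : 2 ≤ M)
  (qb : (Fin d → ZMod M) → Site d)
  (A : Site d → Fin d → 𝔸)
  (Ab : (Fin d → ZMod (L * M)) × Fin d → ℝ) (hA : ∀ (y : Site d) (ν : Fin d), Ab (tcls (L * M) y, ν) = ‖A y ν‖)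
  (Bx : (Fin d → ZMod M) × Fin d → Finset ((Fin d → ZMod (L * M)) × Fin d))
  (hBx : ∀ c, Bx c = (bondsIn (qb c.1) (bondHi L (qb c.1) c.2)).image (fun b : Site d × Fin d => (tcls (L * M) b.1, b.2)))

include hL hM hA hBx in
/-- **A BOX BOND SUM IS A TORUS SUM**: `Σ_{b ∈ bondsIn (qb y) (bondHi L (qb y) κ)} ‖A(b)‖² = Σ_{β ∈ Bx (y,κ)} Ab β²` (`2 ≤ M`). [folklore] -/
theorem sum_bondsIn_eq_sum_Bx (c : (Fin d → ZMod M) × Fin d) :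
    ∑ b ∈ bondsIn (qb c.1) (bondHi L (qb c.1) c.2), ‖A b.1 b.2‖ ^ 2 = ∑ β ∈ Bx c, Ab β ^ 2 := by
  classical
  rw [hBx, Finset.sum_image (tcls_injOn_bondsIn L M hL hM (qb c.1) c.2)]
  exact Finset.sum_congr rfl fun b _ => by rw [hA]

end Reindex

/-! ## §4 The torus multiplicity `2d` by lifting to `ℤ^d` -/

section Count

variable (L M : ℕ) [NeZero M] [NeZero (L * M)] (hL : 1 ≤ L)
  (qb : (Fin d → ZMod M) → Site d) (hqb : ∀ y i, qb y i = (L : ℤ) * (((y i).val : ℕ) : ℤ))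
  (Bx : (Fin d → ZMod M) × Fin d → Finset ((Fin d → ZMod (L * M)) × Fin d))
  (hBx : ∀ c, Bx c = (bondsIn (qb c.1) (bondHi L (qb c.1) c.2)).image (fun b : Site d × Fin d => (tcls (L * M) b.1, b.2)))

include hqb hBx in
/-- **LIFTING**: if the torus fine bond `β` lies in `Bx (y, κ)`, then the standard representative `(tlift β₋, dir β)` lies in the `ℤ^d` box of a
`ℤ^d` coarse bond `(ỹ, κ)` of the `L`-lattice with `ỹ ≡ y (mod M)` (translate the witness's box by its period vector). [folklore] -/
theorem exists_lift_of_mem_Bx (β : (Fin d → ZMod (L * M)) × Fin d) (c : (Fin d → ZMod M) × Fin d) (hc : β ∈ Bx c) :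
    ∃ yt : Site d, (∀ i, ((yt i : ℤ) : ZMod M) = c.1 i) ∧
      (tlift β.1, β.2) ∈ bondsIn (loK L 1 yt) (bondHi L (loK L 1 yt) c.2) := by
  classical
  rw [hBx, Finset.mem_image] at hc
  obtain ⟨⟨x, ν⟩, hb, rfl⟩ := hc
  dsimp only
  -- the period vector of the witness
  obtain ⟨m, hm⟩ := (tcls_eq_tcls_iff (L * M)).1
    (show tcls (L * M) x = tcls (L * M) (tlift (tcls (L * M) x)) by rw [tcls_tlift])
  refine ⟨fun i => (((c.1 i).val : ℕ) : ℤ) + (M : ℤ) * m i, fun i => ?_, ?_⟩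
  · push_cast
    rw [ZMod.natCast_zmod_val, ZMod.natCast_self, zero_mul, add_zero]
  · have hlo : loK L 1 (fun i => (((c.1 i).val : ℕ) : ℤ) + (M : ℤ) * m i) = qb c.1 + ((L * M : ℕ) : ℤ) • m := by
      funext i
      simp only [loK, pow_one, hqb, Pi.add_apply, Pi.smul_apply, smul_eq_mul]
      push_cast
      ring
    rw [hlo, hm]
    exact (mem_bondsIn_add_iff L (qb c.1) (((L * M : ℕ) : ℤ) • m) c.2 x ν).2 hb

include hL hqb hBx in
/-- **TORUS MULTIPLICITY `2d`**: a fine bond of `(ℤ∕LM)^d` lies in the box class `Bx c` of at most `2d` coarse bonds `c` of `(ℤ∕M)^d` — by an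
injective lift into the `ℤ^d` count `…OneStepAveragingRemainder.card_filter_box_le` BY NAME. [folklore] -/
theorem card_filter_Bx_le (β : (Fin d → ZMod (L * M)) × Fin d) :
    (univ.filter fun c : (Fin d → ZMod M) × Fin d => β ∈ Bx c).card ≤ 2 * d := by
  classical
  set S := univ.filter fun c : (Fin d → ZMod M) × Fin d => β ∈ Bx c with hS
  have hex : ∀ c ∈ S, ∃ yt : Site d, (∀ i, ((yt i : ℤ) : ZMod M) = c.1 i) ∧
      (tlift β.1, β.2) ∈ bondsIn (loK L 1 yt) (bondHi L (loK L 1 yt) c.2) := fun c hc =>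
    exists_lift_of_mem_Bx L M qb hqb Bx hBx β c (Finset.mem_filter.1 hc).2
  choose! g hg using hex
  -- the lift `c ↦ (g c, dir c)` is injective on `S`
  have hinj : Set.InjOn (fun c : (Fin d → ZMod M) × Fin d => (g c, c.2)) S := by
    rintro ⟨y, κ⟩ hc ⟨y', κ'⟩ hc' h
    simp only [Prod.mk.injEq] at h ⊢
    refine ⟨funext fun i => ?_, h.2⟩
    have e1 := (hg _ hc).1 i
    have e2 := (hg _ hc').1 i
    dsimp only at e1 e2
    rw [← e1, ← e2, h.1]
  -- its image is a family of `ℤ^d` coarse bonds all of whose boxes contain the representative of `β`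
  set Λ := S.image fun c : (Fin d → ZMod M) × Fin d => (g c, c.2) with hΛ
  have hall : Λ.filter (fun C : Site d × Fin d => (tlift β.1, β.2) ∈ bondsIn (loK L 1 C.1) (bondHi L (loK L 1 C.1) C.2)) = Λ := by
    refine Finset.filter_true_of_mem fun C hC => ?_
    obtain ⟨c, hc, rfl⟩ := Finset.mem_image.1 hC
    exact (hg c hc).2
  calc S.card = Λ.card := (Finset.card_image_of_injOn hinj).symm
    _ = (Λ.filter fun C : Site d × Fin d =>
          (tlift β.1, β.2) ∈ bondsIn (loK L 1 C.1) (bondHi L (loK L 1 C.1) C.2)).card := by rw [hall]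
    _ ≤ 2 * d := OneStepAveragingRemainder.card_filter_box_le L hL Λ (tlift β.1, β.2)

include hL hqb hBx in
/-- **THE DOUBLE COUNT ON THE TORUS**: `Σ_c Σ_{β ∈ Bx c} g β ≤ 2d·Σ_β g β` for `g ≥ 0` (`…OneStepAveragingRemainder.sum_sum_filter_le` BY NAME with
the torus multiplicity). [folklore] -/
theorem sum_sum_Bx_le (g : (Fin d → ZMod (L * M)) × Fin d → ℝ) (hg : ∀ β, 0 ≤ g β) :
    ∑ c, ∑ β ∈ Bx c, g β ≤ ((2 * d : ℕ) : ℝ) * ∑ β, g β := by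
  classical
  exact OneStepAveragingRemainder.sum_sum_filter_le univ Bx univ (fun c _ => Finset.subset_univ _)
    (fun β _ => card_filter_Bx_le L M hL qb hqb Bx hBx β) g (fun β _ => hg β)

end Count

/-! ## §5 The (R-M) letter at `k = 1` on the two-scale torus -/

section Letter

variable {𝔸 : Type*} [NormedRing 𝔸] [NormedAlgebra ℂ 𝔸] [NormOneClass 𝔸] [CompleteSpace 𝔸]
variable (L M : ℕ) [NeZero M] [NeZero (L * M)] (hL : 1 ≤ L) (hM : 2 ≤ M)
  {V₀ : Site d → Fin d → 𝔸ˣ} (hV₀ : ∀ x κ, V₀ x κ ∈ U1 𝔸)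
  {α₀ : ℝ} (hα₀ : 0 ≤ α₀) (hsmall : 512 * (d + 1) * (d + 4) * (L : ℝ) ^ 2 * α₀ ≤ 1)
  (h44 : ∀ (x : Site d) (κ κ' : Fin d), κ ≠ κ' → ‖((hol V₀ x (plaqWord κ κ') : 𝔸ˣ) : 𝔸) - 1‖ ≤ α₀)
  (qb : (Fin d → ZMod M) → Site d) (hqb : ∀ y i, qb y i = (L : ℤ) * (((y i).val : ℕ) : ℤ))
  (A : Site d → Fin d → 𝔸)
  (Ab : (Fin d → ZMod (L * M)) × Fin d → ℝ) (hA : ∀ (y : Site d) (ν : Fin d), Ab (tcls (L * M) y, ν) = ‖A y ν‖)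

include hL hM hV₀ hα₀ hsmall h44 hqb hA in
/-- **THE (R-M) LETTER AT `k = 1` ON THE TORUS, [B7]'s NORMALISATION**: `Σ_c ‖linQcov − L • Q0cov‖²(qb c.1, c.2) ≤ (50(d+1)εL)²·2d·Σ_β Ab β²`,
`ε = 16(d+1)(d+4)L²α₀`. [folklore] -/
theorem sum_normSq_remainder_torus_le' :
    ∑ c : (Fin d → ZMod M) × Fin d, ‖linQcov L V₀ A (qb c.1) c.2 - (L : ℝ) • Q0cov L V₀ A (qb c.1) c.2‖ ^ 2
      ≤ (50 * (d + 1) * (16 * (d + 1) * (d + 4) * (L : ℝ) ^ 2 * α₀) * L) ^ 2 * ((2 * d : ℕ) : ℝ) * ∑ β, Ab β ^ 2 := by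
  classical
  have hε0 : (0 : ℝ) ≤ 16 * (d + 1) * (d + 4) * (L : ℝ) ^ 2 * α₀ := by positivity
  have hε : 16 * (d + 1) * (d + 4) * (L : ℝ) ^ 2 * α₀ ≤ 1 / 8 := by nlinarith
  have hW : ∀ (q : Site d) (κ : Fin d) (r : Fin d → Fin L),
      ‖((Wcx L V₀ q κ (boxVec L r) : 𝔸ˣ) : 𝔸) - 1‖ ≤ 16 * (d + 1) * (d + 4) * (L : ℝ) ^ 2 * α₀ := fun q κ r =>
    (B7Prop2Explicit.norm_Wcx_sub_one_le L hL V₀ hV₀ hα₀ hsmall h44 q κ r).trans (le_of_eq (by ring))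
  -- per coarse bond, then re-index each box to the torus, then the double count
  have h1 : ∀ c : (Fin d → ZMod M) × Fin d,
      ‖linQcov L V₀ A (qb c.1) c.2 - (L : ℝ) • Q0cov L V₀ A (qb c.1) c.2‖ ^ 2
        ≤ (50 * (d + 1) * (16 * (d + 1) * (d + 4) * (L : ℝ) ^ 2 * α₀) * L) ^ 2
          * ∑ β ∈ (bondsIn (qb c.1) (bondHi L (qb c.1) c.2)).image (fun b : Site d × Fin d => (tcls (L * M) b.1, b.2)), Ab β ^ 2 :=
    fun c => by
      rw [← sum_bondsIn_eq_sum_Bx L M hL hM qb A Ab hA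
        (fun c => (bondsIn (qb c.1) (bondHi L (qb c.1) c.2)).image (fun b : Site d × Fin d => (tcls (L * M) b.1, b.2))) (fun _ => rfl) c]
      exact OneStepAveragingRemainder.normSq_remainder_le_local L hV₀ hL (qb c.1) c.2 hε0 hε (hW (qb c.1) c.2) A
  have h2 := sum_sum_Bx_le L M hL qb hqb
    (fun c => (bondsIn (qb c.1) (bondHi L (qb c.1) c.2)).image (fun b : Site d × Fin d => (tcls (L * M) b.1, b.2))) (fun _ => rfl)
    (fun β => Ab β ^ 2) (fun β => sq_nonneg _)
  calc _ ≤ ∑ c : (Fin d → ZMod M) × Fin d, (50 * (d + 1) * (16 * (d + 1) * (d + 4) * (L : ℝ) ^ 2 * α₀) * L) ^ 2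
          * ∑ β ∈ (bondsIn (qb c.1) (bondHi L (qb c.1) c.2)).image (fun b : Site d × Fin d => (tcls (L * M) b.1, b.2)), Ab β ^ 2 :=
        Finset.sum_le_sum fun c _ => h1 c
    _ = (50 * (d + 1) * (16 * (d + 1) * (d + 4) * (L : ℝ) ^ 2 * α₀) * L) ^ 2
          * ∑ c : (Fin d → ZMod M) × Fin d,
            ∑ β ∈ (bondsIn (qb c.1) (bondHi L (qb c.1) c.2)).image (fun b : Site d × Fin d => (tcls (L * M) b.1, b.2)), Ab β ^ 2 := by
        rw [Finset.mul_sum]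
    _ ≤ (50 * (d + 1) * (16 * (d + 1) * (d + 4) * (L : ℝ) ^ 2 * α₀) * L) ^ 2 * (((2 * d : ℕ) : ℝ) * ∑ β, Ab β ^ 2) :=
        mul_le_mul_of_nonneg_left h2 (sq_nonneg _)
    _ = _ := by ring

include hL hM hV₀ hα₀ hsmall h44 hqb hA in
/-- **THE (R-M) LETTER AT `k = 1` ON THE TORUS, UNIT NORMALISATION** (the remainder `E = L⁻¹·L(Q(V₀)A) − Q₀A` of the split `Q = M + E` with
`M = Q₀`, `|Q₀A| ≤ |A|` as in (125)–(126)): `Σ_c ‖L⁻¹ • linQcov − Q0cov‖²(qb c.1, c.2) ≤ (50(d+1)ε)²·2d·Σ_β Ab β²`, `ε = 16(d+1)(d+4)L²α₀` —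
`…AveragedCurlFormSplit.curlForm_letter_of_split`'s `hE` with `c_E := (50(d+1)ε)²·2d`. [folklore] -/
theorem sum_normSq_remainder_torus_le :
    ∑ c : (Fin d → ZMod M) × Fin d, ‖(L : ℝ)⁻¹ • linQcov L V₀ A (qb c.1) c.2 - Q0cov L V₀ A (qb c.1) c.2‖ ^ 2
      ≤ (50 * (d + 1) * (16 * (d + 1) * (d + 4) * (L : ℝ) ^ 2 * α₀)) ^ 2 * ((2 * d : ℕ) : ℝ) * ∑ β, Ab β ^ 2 := by
  have hLpos : (0 : ℝ) < L := by exact_mod_cast hL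
  have hL0 : (L : ℝ) ≠ 0 := hLpos.ne'
  have hsc : ∀ c : (Fin d → ZMod M) × Fin d,
      ‖(L : ℝ)⁻¹ • linQcov L V₀ A (qb c.1) c.2 - Q0cov L V₀ A (qb c.1) c.2‖ ^ 2
        = ((L : ℝ) ^ 2)⁻¹ * ‖linQcov L V₀ A (qb c.1) c.2 - (L : ℝ) • Q0cov L V₀ A (qb c.1) c.2‖ ^ 2 := fun c => by
    have hx : (L : ℝ)⁻¹ • linQcov L V₀ A (qb c.1) c.2 - Q0cov L V₀ A (qb c.1) c.2
        = (L : ℝ)⁻¹ • (linQcov L V₀ A (qb c.1) c.2 - (L : ℝ) • Q0cov L V₀ A (qb c.1) c.2) := by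
      rw [smul_sub, smul_smul, inv_mul_cancel₀ hL0, one_smul]
    rw [hx, norm_smul, mul_pow, norm_inv, Real.norm_natCast, inv_pow]
  simp_rw [hsc]
  rw [← Finset.mul_sum]
  have h := sum_normSq_remainder_torus_le' L M hL hM hV₀ hα₀ hsmall h44 qb hqb A Ab hA
  have hL2 : (0 : ℝ) < (L : ℝ) ^ 2 := by positivity
  calc ((L : ℝ) ^ 2)⁻¹ * ∑ c : (Fin d → ZMod M) × Fin d, ‖linQcov L V₀ A (qb c.1) c.2 - (L : ℝ) • Q0cov L V₀ A (qb c.1) c.2‖ ^ 2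
      ≤ ((L : ℝ) ^ 2)⁻¹ * ((50 * (d + 1) * (16 * (d + 1) * (d + 4) * (L : ℝ) ^ 2 * α₀) * L) ^ 2 * ((2 * d : ℕ) : ℝ) * ∑ β, Ab β ^ 2) :=
        mul_le_mul_of_nonneg_left h (by positivity)
    _ = _ := by field_simp

end Letter

end Summit.QuantumFields.BalabanUV.T4Continuum.NE7b.OneStepRemainderTorus

end
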